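import Summits.Ventures.LatticeQCDFlow.Scaling.ParallelTemperingTagWalk

/-!
HONEST FRAMING: exact (Metropolis-corrected) sampling algorithms for lattice gauge theory; figures
of merit are autocorrelation/cost numbers at stated couplings and volumes; no continuum-physics
claim.

# SimulatedTemperingDeliveryTime — THE DELIVERY TIME OF THE TEMPERING SAMPLERS ON AN ARBITRARY LADDER, EXACTLY:
# `E_0(τ_K) = Σ_{k<K} 2(k+1)/ov(β_k, β_{k+1})` (SIMULATED TEMPERING) AND `= Σ_{k<K} K(k+1)/swapAcc(β_k, β_{k+1})`
# (REPLICA EXCHANGE, PER ATTEMPT) UNDER PERFECT WITHIN-LEVEL SAMPLING (lean-2 GEN-14, ours; a ladder-design objective)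

Venture-side (OURS).  Cell `lqcd-flow` (pub-lqcd), unit `pub-lqcd-lean-2-g14`, 2026-08-24.  `Scaling/SimulatedTemperingLevelWalk`
and `Scaling/ParallelTemperingTagWalk` identified the level / tag process of GEN-14's constructed samplers under perfect
within-level sampling with the Literature's birth–death matrices `bdKernel K p q` (`p_k = ½ov_k`, `q_k = ½ov_{k−1}`;
`p_τ = swapAcc_τ/K`, `q_τ = swapAcc_{τ−1}/K`), and evaluated the delivery time only for UNIFORM ladders via row 22's
`ladder_delivery_time'`.  Here the ladder is ARBITRARY: both walks have `p_k = q_{k+1}`, so every Levin–Peres weight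
`w_k = Π_{i<k} p_i/q_{i+1}` equals `1`, eq. (2.13) of [LevinPeres2017, §2.5] (tree: `LevinPeres2017_eq_2_13_div`) gives the
one-rung passage time `E_k(τ_{k+1}) = (k+1)/q_{k+1}` and the telescoping display after (2.13) (`LevinPeres2017_sec_2_5_sum`)
the delivery time — a closed form in the adjacent overlaps / swap acceptances alone, hence an explicit objective for
ladder design: `E_0(τ_K) = 2·Σ_{k<K} (k+1)/ov_k` resp. `K·Σ_{k<K} (k+1)/swapAcc_k`.  With `ov_k ≥ a` this is `≤ K(K+1)/a`
(row 22's uniform value), and since `ov_k ≤ 1` always `≥ K(K+1)`.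

## What is proved (`μ` probability, `X` bounded measurable)

* `stOverlap_pos`, `stOverlap_le_one`; `stLevelWalk_isRowStochastic`, `stLevelWalk_isIrreducible`,
  `existsUnique_stLevelWalk_hittingTime`; `stLevelWalk_bdWeight` (`w_k = 1`); **`stLevelWalk_step_time`**
  (`E_k(τ_{k+1}) = 2(k+1)/ov_k`); **`stLevelWalk_delivery_time`** (`E_0(τ_K) = Σ_{k<K} 2(k+1)/ov_k`);
  `sum_fin_val_add_one`; **`stLevelWalk_delivery_time_le`** (`≤ K(K+1)/a` if `ov_k ≥ a > 0`),
  **`stLevelWalk_delivery_time_ge`** (`≥ K(K+1)`).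
* PT: `ptSwapAcc_pos`; `ptLevelWalk_isRowStochastic`, `ptLevelWalk_isIrreducible`, `existsUnique_ptLevelWalk_hittingTime`,
  `ptLevelWalk_bdWeight`; **`ptLevelWalk_step_time`** (`E_τ(τ_{τ+1}) = K(τ+1)/swapAcc_τ` attempts);
  **`ptLevelWalk_delivery_time`** (`E_0(τ_K) = Σ_{τ<K} K(τ+1)/swapAcc_τ`).

NOT CLAIMED: the path-space identification of `IsHittingTimeSolution` with expected hitting times (matrix-side in the
tree, as in row 22's file); optimisation over ladders; anything measured.  Literature grade (cell rule): KNOWN RESULT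
(Levin–Peres (2.13)) APPLIED to the tree's constructed samplers; new typing only.
-/

noncomputable section

open MeasureTheory ProbabilityTheory Set Filter Finset
open Summit.Ventures.LatticeQCDFlow.Scoring
open Literature.Probability.MarkovChains
open scoped ENNReal

namespace Summit.Ventures.LatticeQCDFlow.Scaling

/-- `Σ_{i<K} (i+1) = K(K+1)/2` over `Fin K`. [folklore] -/
theorem sum_fin_val_add_one (K : ℕ) : (∑ i : Fin K, (((i : ℕ) : ℝ) + 1)) = (K : ℝ) * (K + 1) / 2 := by
  induction K with
  | zero => simp
  | succ K ih =>
    rw [Fin.sum_univ_castSucc]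
    simp only [Fin.val_castSucc, Fin.val_last]
    rw [ih]; push_cast; ring

section ST

variable {Ω : Type*} [MeasurableSpace Ω] {X : Ω → ℝ} {μ : Measure Ω} [IsProbabilityMeasure μ] {β : ℕ → ℝ}
  {K : ℕ}

/-- **Adjacent overlaps are positive.** [ours] -/
theorem stOverlap_pos (hXm : Measurable X) (hXb : ∃ C, ∀ x, |X x| ≤ C) (k : ℕ) : 0 < stOverlap X μ β k := by
  unfold stOverlap; exact st_overlap_pos hXm hXb _ _

/-- **Adjacent overlaps are at most one** (`½ov_k = ∫ stUpProb ≤ ½`). [ours] -/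
theorem stOverlap_le_one (hXm : Measurable X) (hXb : ∃ C, ∀ x, |X x| ≤ C) (k : ℕ) : stOverlap X μ β k ≤ 1 := by
  have hk : k < k + 1 + 1 := by omega
  have key : stLadderUp X μ β (k + 1) (((⟨k, hk⟩ : Fin (k + 1 + 1)) : ℕ)) ≤ 1 / 2 := by
    rw [← integral_stUpProb (K := k + 1) hXm hXb ⟨k, hk⟩]
    haveI := isProbabilityMeasure_tilted_mul (μ := μ) hXm hXb (β (((⟨k, hk⟩ : Fin (k + 1 + 1)) : ℕ)))
    calc ∫ x, stUpProb X μ β (k + 1) ((⟨k, hk⟩ : Fin (k + 1 + 1)), x)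
          ∂(μ.tilted fun x => β (((⟨k, hk⟩ : Fin (k + 1 + 1)) : ℕ)) * X x)
        ≤ ∫ _x, (1 / 2 : ℝ) ∂(μ.tilted fun x => β (((⟨k, hk⟩ : Fin (k + 1 + 1)) : ℕ)) * X x) :=
          integral_mono_of_nonneg (ae_of_all _ fun x => stUpProb_nonneg _) (integrable_const _)
            (ae_of_all _ fun x => stUpProb_le_half _)
      _ = 1 / 2 := by rw [integral_const, probReal_univ, one_smul]
  have hv : (((⟨k, hk⟩ : Fin (k + 1 + 1)) : ℕ)) = k := rfl
  rw [hv] at key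
  unfold stLadderUp at key
  rw [if_pos (by omega)] at key
  linarith

/-- The lumped level walk is row-stochastic. [ours] -/
theorem stLevelWalk_isRowStochastic (hXm : Measurable X) (hXb : ∃ C, ∀ x, |X x| ≤ C) :
    IsRowStochastic (stLevelWalk X μ β K) := by
  unfold stLevelWalk
  refine bdKernel_isRowStochastic (fun k => ?_) (fun k => ?_) (fun k => ?_) (if_pos rfl) (if_neg (lt_irrefl K))
  · unfold stLadderUp; split_ifs
    · exact div_nonneg (stOverlap_pos hXm hXb k).le two_pos.le
    · exact le_rfl
  · unfold stLadderDown; split_ifs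
    · exact le_rfl
    · exact div_nonneg (stOverlap_pos hXm hXb _).le two_pos.le
  · have h1 := stOverlap_le_one (μ := μ) (β := β) hXm hXb k
    have h2 := stOverlap_le_one (μ := μ) (β := β) hXm hXb (k - 1)
    have h3 := (stOverlap_pos (μ := μ) (β := β) hXm hXb k).le
    have h4 := (stOverlap_pos (μ := μ) (β := β) hXm hXb (k - 1)).le
    unfold stLadderUp stLadderDown; split_ifs <;> linarith

/-- The lumped level walk is irreducible. [ours] -/
theorem stLevelWalk_isIrreducible (hXm : Measurable X) (hXb : ∃ C, ∀ x, |X x| ≤ C) :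
    IsIrreducible (stLevelWalk X μ β K) := by
  unfold stLevelWalk
  exact bdKernel_isIrreducible (stLevelWalk_isRowStochastic hXm hXb)
    (fun k hk => by unfold stLadderUp; rw [if_pos hk]; exact div_pos (stOverlap_pos hXm hXb k) two_pos)
    (fun k hk _ => by unfold stLadderDown; rw [if_neg (by omega)]; exact div_pos (stOverlap_pos hXm hXb _) two_pos)

/-- **Hitting times of the lumped level walk exist and are unique.** [ours] -/
theorem existsUnique_stLevelWalk_hittingTime (hXm : Measurable X) (hXb : ∃ C, ∀ x, |X x| ≤ C) :
    ∃! hit : Fin (K + 1) → Fin (K + 1) → ℝ, IsHittingTimeSolution (stLevelWalk X μ β K) hit := by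
  have hP := stLevelWalk_isRowStochastic (μ := μ) (β := β) (K := K) hXm hXb
  have hirr := stLevelWalk_isIrreducible (μ := μ) (β := β) (K := K) hXm hXb
  obtain ⟨h, hh⟩ := exists_isHittingTimeSolution hP hirr
  exact ⟨h, hh, fun h' hh' => IsHittingTimeSolution.unique hP hirr hh' hh⟩

/-- **All Levin–Peres weights are one**: `w_k = Π_{i<k} (½ov_i)/(½ov_i) = 1` (`k ≤ K`). [ours] -/
theorem stLevelWalk_bdWeight (hXm : Measurable X) (hXb : ∃ C, ∀ x, |X x| ≤ C) {k : ℕ} (hk : k ≤ K) :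
    bdWeight (stLadderUp X μ β K) (stLadderDown X μ β) k = 1 := by
  induction k with
  | zero => exact bdWeight_zero _ _
  | succ k ih =>
    rw [bdWeight_succ, ih (by omega), one_mul]
    unfold stLadderUp stLadderDown
    rw [if_pos (by omega), if_neg (by omega), Nat.add_sub_cancel]
    exact div_self (ne_of_gt (div_pos (stOverlap_pos hXm hXb k) two_pos))

variable {hit : Fin (K + 1) → Fin (K + 1) → ℝ}

/-- **ONE RUNG COSTS `2(k+1)/ov_k` STEPS**: `E_k(τ_{k+1}) = 2(k+1)/ov(β_k, β_{k+1})` for the lumped level walk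
(Levin–Peres (2.13) with unit weights). [ours] -/
theorem stLevelWalk_step_time (hXm : Measurable X) (hXb : ∃ C, ∀ x, |X x| ≤ C)
    (hh : IsHittingTimeSolution (stLevelWalk X μ β K) hit) (i : Fin K) :
    hit i.castSucc i.succ = 2 * ((i : ℕ) + 1) / stOverlap X μ β i := by
  have hh' : IsHittingTimeSolution (bdKernel K (stLadderUp X μ β K) (stLadderDown X μ β)) hit := hh
  have hp : ∀ k, k < K → stLadderUp X μ β K k ≠ 0 := fun k hk => by
    unfold stLadderUp; rw [if_pos hk]; exact ne_of_gt (div_pos (stOverlap_pos hXm hXb k) two_pos)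
  have hq : ∀ k, 1 ≤ k → k ≤ K → stLadderDown X μ β k ≠ 0 := fun k h1 _ => by
    unfold stLadderDown; rw [if_neg (by omega)]; exact ne_of_gt (div_pos (stOverlap_pos hXm hXb _) two_pos)
  rw [LevinPeres2017_eq_2_13_div hh' (if_pos rfl) hp hq i,
    Finset.sum_congr rfl fun j hj => stLevelWalk_bdWeight hXm hXb (k := j)
      (by have := Finset.mem_range.1 hj; omega),
    Finset.sum_const, Finset.card_range, stLevelWalk_bdWeight hXm hXb (by omega), nsmul_eq_mul, mul_one, mul_one]
  unfold stLadderDown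
  rw [if_neg (by omega), Nat.add_sub_cancel]
  push_cast
  rw [div_div_eq_mul_div]; ring

/-- **THE DELIVERY TIME ON AN ARBITRARY LADDER, EXACTLY**: `E_0(τ_K) = Σ_{k<K} 2(k+1)/ov(β_k, β_{k+1})` for the
lumped level walk of the simulated-tempering sampler under perfect within-level sampling. [ours] -/
theorem stLevelWalk_delivery_time (hXm : Measurable X) (hXb : ∃ C, ∀ x, |X x| ≤ C)
    (hh : IsHittingTimeSolution (stLevelWalk X μ β K) hit) :
    hit 0 (Fin.last K) = ∑ i : Fin K, 2 * ((i : ℕ) + 1) / stOverlap X μ β i := by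
  have hh' : IsHittingTimeSolution (bdKernel K (stLadderUp X μ β K) (stLadderDown X μ β)) hit := hh
  have hp : ∀ k, k < K → stLadderUp X μ β K k ≠ 0 := fun k hk => by
    unfold stLadderUp; rw [if_pos hk]; exact ne_of_gt (div_pos (stOverlap_pos hXm hXb k) two_pos)
  have hq : ∀ k, 1 ≤ k → k ≤ K → stLadderDown X μ β k ≠ 0 := fun k h1 _ => by
    unfold stLadderDown; rw [if_neg (by omega)]; exact ne_of_gt (div_pos (stOverlap_pos hXm hXb _) two_pos)
  rw [LevinPeres2017_sec_2_5_sum hh' (if_pos rfl) hp hq (Fin.zero_le _)]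
  refine Finset.sum_congr rfl fun i _ => ?_
  rw [if_pos ⟨by simp, by rw [Fin.val_last]; exact i.isLt⟩, stLevelWalk_step_time hXm hXb hh i]

/-- **Uniform lower overlap ⇒ row 22's value is an upper bound**: `ov_k ≥ a > 0` for `k < K` ⇒
`E_0(τ_K) ≤ K(K+1)/a`. [ours] -/
theorem stLevelWalk_delivery_time_le (hXm : Measurable X) (hXb : ∃ C, ∀ x, |X x| ≤ C)
    (hh : IsHittingTimeSolution (stLevelWalk X μ β K) hit) {a : ℝ} (ha : 0 < a)
    (hov : ∀ k, k < K → a ≤ stOverlap X μ β k) :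
    hit 0 (Fin.last K) ≤ (K : ℝ) * (K + 1) / a := by
  rw [stLevelWalk_delivery_time hXm hXb hh]
  calc ∑ i : Fin K, 2 * (((i : ℕ) : ℝ) + 1) / stOverlap X μ β i
      ≤ ∑ i : Fin K, 2 * (((i : ℕ) : ℝ) + 1) / a :=
        Finset.sum_le_sum fun i _ => div_le_div_of_nonneg_left (by positivity) ha (hov i i.isLt)
    _ = (K : ℝ) * (K + 1) / a := by
        rw [← Finset.sum_div, ← Finset.mul_sum, sum_fin_val_add_one]; ring

/-- **And `K(K+1)` is a lower bound** (`ov_k ≤ 1`): even a perfectly overlapping ladder needs `K(K+1)` steps. [ours] -/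
theorem stLevelWalk_delivery_time_ge (hXm : Measurable X) (hXb : ∃ C, ∀ x, |X x| ≤ C)
    (hh : IsHittingTimeSolution (stLevelWalk X μ β K) hit) :
    (K : ℝ) * (K + 1) ≤ hit 0 (Fin.last K) := by
  rw [stLevelWalk_delivery_time hXm hXb hh]
  calc (K : ℝ) * (K + 1) = ∑ i : Fin K, 2 * (((i : ℕ) : ℝ) + 1) / 1 := by
        rw [← Finset.sum_div, ← Finset.mul_sum, sum_fin_val_add_one]; ring
    _ ≤ ∑ i : Fin K, 2 * (((i : ℕ) : ℝ) + 1) / stOverlap X μ β i :=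
        Finset.sum_le_sum fun i _ => div_le_div_of_nonneg_left (by positivity) (stOverlap_pos hXm hXb _)
          (stOverlap_le_one hXm hXb _)

end ST

section PT

variable {Ω : Type*} [MeasurableSpace Ω] {X : Ω → ℝ} {μ : Measure Ω} [IsProbabilityMeasure μ] {β : ℕ → ℝ}
  {K : ℕ}

/-- Swap acceptances are positive (GEN-11's `swapAcc_ge_exp_neg`). [ours] -/
theorem ptSwapAcc_pos (hXm : Measurable X) (hXb : ∃ C, ∀ x, |X x| ≤ C) (s t : ℝ) : 0 < swapAcc X μ s t :=
  lt_of_lt_of_le (Real.exp_pos _) (swapAcc_ge_exp_neg hXm hXb s t)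

/-- The lumped tag walk is row-stochastic. [ours] -/
theorem ptLevelWalk_isRowStochastic (hXm : Measurable X) (hXb : ∃ C, ∀ x, |X x| ≤ C) :
    IsRowStochastic (ptLevelWalk X μ β K) := by
  unfold ptLevelWalk
  have hK0 : (0 : ℝ) ≤ K := Nat.cast_nonneg _
  refine bdKernel_isRowStochastic (fun k => ?_) (fun k => ?_) (fun k => ?_) (if_pos rfl) (if_neg (lt_irrefl K))
  · unfold ptLadderUp; split_ifs
    · exact div_nonneg (swapAcc_nonneg _ _) hK0
    · exact le_rfl
  · unfold ptLadderDown; split_ifs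
    · exact le_rfl
    · exact div_nonneg (swapAcc_nonneg _ _) hK0
  · have h1 := swapAcc_le_one (μ := μ) hXm hXb (β k) (β (k + 1))
    have h2 := swapAcc_le_one (μ := μ) hXm hXb (β (k - 1)) (β k)
    have h3 := swapAcc_nonneg (X := X) (μ := μ) (β k) (β (k + 1))
    have h4 := swapAcc_nonneg (X := X) (μ := μ) (β (k - 1)) (β k)
    unfold ptLadderUp ptLadderDown
    split_ifs with hA hB
    · rw [add_zero]; exact (div_le_one (by exact_mod_cast (show 0 < K by omega))).2
        (h1.trans (by exact_mod_cast (show 1 ≤ K by omega)))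
    · -- interior rung: `K ≥ 2`
      have hK2 : (2 : ℝ) ≤ K := by exact_mod_cast (show 2 ≤ K by omega)
      have hKp : (0 : ℝ) < K := by linarith
      rw [← add_div, div_le_one hKp]; linarith
    · rw [zero_add]; exact zero_le_one
    · rw [zero_add]
      rcases Nat.eq_zero_or_pos K with hK | hK
      · subst hK; simp
      · exact (div_le_one (by exact_mod_cast hK)).2 (h2.trans (by exact_mod_cast hK))

/-- The lumped tag walk is irreducible (`K ≥ 1`). [ours] -/
theorem ptLevelWalk_isIrreducible (hXm : Measurable X) (hXb : ∃ C, ∀ x, |X x| ≤ C) (hK : 1 ≤ K) :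
    IsIrreducible (ptLevelWalk X μ β K) := by
  have hKp : (0 : ℝ) < K := by exact_mod_cast hK
  unfold ptLevelWalk
  exact bdKernel_isIrreducible (ptLevelWalk_isRowStochastic hXm hXb)
    (fun k hk => by unfold ptLadderUp; rw [if_pos hk]; exact div_pos (ptSwapAcc_pos hXm hXb _ _) hKp)
    (fun k hk _ => by unfold ptLadderDown; rw [if_neg (by omega)]; exact div_pos (ptSwapAcc_pos hXm hXb _ _) hKp)

/-- **Hitting times of the lumped tag walk exist and are unique** (`K ≥ 1`). [ours] -/
theorem existsUnique_ptLevelWalk_hittingTime (hXm : Measurable X) (hXb : ∃ C, ∀ x, |X x| ≤ C) (hK : 1 ≤ K) :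
    ∃! hit : Fin (K + 1) → Fin (K + 1) → ℝ, IsHittingTimeSolution (ptLevelWalk X μ β K) hit := by
  have hP := ptLevelWalk_isRowStochastic (μ := μ) (β := β) (K := K) hXm hXb
  have hirr := ptLevelWalk_isIrreducible (μ := μ) (β := β) hXm hXb hK
  obtain ⟨h, hh⟩ := exists_isHittingTimeSolution hP hirr
  exact ⟨h, hh, fun h' hh' => IsHittingTimeSolution.unique hP hirr hh' hh⟩

/-- All Levin–Peres weights of the tag walk are one (`k ≤ K`, `K ≥ 1`). [ours] -/
theorem ptLevelWalk_bdWeight (hXm : Measurable X) (hXb : ∃ C, ∀ x, |X x| ≤ C) (hK : 1 ≤ K) {k : ℕ} (hk : k ≤ K) :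
    bdWeight (ptLadderUp X μ β K) (ptLadderDown X μ β K) k = 1 := by
  have hKp : (0 : ℝ) < K := by exact_mod_cast hK
  induction k with
  | zero => exact bdWeight_zero _ _
  | succ k ih =>
    rw [bdWeight_succ, ih (by omega), one_mul]
    unfold ptLadderUp ptLadderDown
    rw [if_pos (by omega), if_neg (by omega), Nat.add_sub_cancel]
    exact div_self (ne_of_gt (div_pos (ptSwapAcc_pos hXm hXb _ _) hKp))

variable {hit : Fin (K + 1) → Fin (K + 1) → ℝ}

/-- **ONE RUNG COSTS `K(τ+1)/swapAcc_τ` ATTEMPTS**: `E_τ(τ_{τ+1}) = K(τ+1)/swapAcc(β_τ, β_{τ+1})`. [ours] -/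
theorem ptLevelWalk_step_time (hXm : Measurable X) (hXb : ∃ C, ∀ x, |X x| ≤ C) (hK : 1 ≤ K)
    (hh : IsHittingTimeSolution (ptLevelWalk X μ β K) hit) (i : Fin K) :
    hit i.castSucc i.succ = (K : ℝ) * ((i : ℕ) + 1) / swapAcc X μ (β i) (β ((i : ℕ) + 1)) := by
  have hKp : (0 : ℝ) < K := by exact_mod_cast hK
  have hh' : IsHittingTimeSolution (bdKernel K (ptLadderUp X μ β K) (ptLadderDown X μ β K)) hit := hh
  have hp : ∀ k, k < K → ptLadderUp X μ β K k ≠ 0 := fun k hk => by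
    unfold ptLadderUp; rw [if_pos hk]; exact ne_of_gt (div_pos (ptSwapAcc_pos hXm hXb _ _) hKp)
  have hq : ∀ k, 1 ≤ k → k ≤ K → ptLadderDown X μ β K k ≠ 0 := fun k h1 _ => by
    unfold ptLadderDown; rw [if_neg (by omega)]; exact ne_of_gt (div_pos (ptSwapAcc_pos hXm hXb _ _) hKp)
  rw [LevinPeres2017_eq_2_13_div hh' (if_pos rfl) hp hq i,
    Finset.sum_congr rfl fun j hj => ptLevelWalk_bdWeight hXm hXb hK (k := j)
      (by have := Finset.mem_range.1 hj; omega),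
    Finset.sum_const, Finset.card_range, ptLevelWalk_bdWeight hXm hXb hK (by omega), nsmul_eq_mul, mul_one,
    mul_one]
  unfold ptLadderDown
  rw [if_neg (by omega), Nat.add_sub_cancel]
  push_cast
  rw [div_div_eq_mul_div]; ring

/-- **THE PTBC DELIVERY TIME ON AN ARBITRARY LADDER, EXACTLY**: `E_0(τ_K) = Σ_{τ<K} K(τ+1)/swapAcc(β_τ, β_{τ+1})`
swap attempts for the lumped tag walk under perfect replica updates (`K ≥ 1`). [ours] -/
theorem ptLevelWalk_delivery_time (hXm : Measurable X) (hXb : ∃ C, ∀ x, |X x| ≤ C) (hK : 1 ≤ K)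
    (hh : IsHittingTimeSolution (ptLevelWalk X μ β K) hit) :
    hit 0 (Fin.last K) = ∑ i : Fin K, (K : ℝ) * ((i : ℕ) + 1) / swapAcc X μ (β i) (β ((i : ℕ) + 1)) := by
  have hKp : (0 : ℝ) < K := by exact_mod_cast hK
  have hh' : IsHittingTimeSolution (bdKernel K (ptLadderUp X μ β K) (ptLadderDown X μ β K)) hit := hh
  have hp : ∀ k, k < K → ptLadderUp X μ β K k ≠ 0 := fun k hk => by
    unfold ptLadderUp; rw [if_pos hk]; exact ne_of_gt (div_pos (ptSwapAcc_pos hXm hXb _ _) hKp)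
  have hq : ∀ k, 1 ≤ k → k ≤ K → ptLadderDown X μ β K k ≠ 0 := fun k h1 _ => by
    unfold ptLadderDown; rw [if_neg (by omega)]; exact ne_of_gt (div_pos (ptSwapAcc_pos hXm hXb _ _) hKp)
  rw [LevinPeres2017_sec_2_5_sum hh' (if_pos rfl) hp hq (Fin.zero_le _)]
  refine Finset.sum_congr rfl fun i _ => ?_
  rw [if_pos ⟨by simp, by rw [Fin.val_last]; exact i.isLt⟩, ptLevelWalk_step_time hXm hXb hK hh i]

end PT

end Summit.Ventures.LatticeQCDFlow.Scaling

end
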